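import Mathlib.MeasureTheory.Integral.Average
import Mathlib.MeasureTheory.Function.LpSeminorm.CompareExp
import Mathlib.MeasureTheory.Function.LpSeminorm.Indicator
import Mathlib.MeasureTheory.Measure.OpenPos
import Mathlib.Topology.Connected.Clopen
import HarnessLib

/-!
# Gluing Poincaré inequalities along a finite chain of overlapping pieces

Elementary `L^p` bookkeeping used to pass from Poincaré(-Wirtinger) inequalities on the pieces
`U_i` of a finite open cover of a connected open set `Ω` to a Poincaré inequality on `Ω` itself
(Maz'ya, *Sobolev Spaces* (1985), §1.1.11, proof of the Lemma: "summing over all `G`" after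
comparing averages along a chain of overlapping balls). Everything here is measure theory on an
arbitrary measure space; no Sobolev notions occur. For a measure `μ`, a set `S` with
`μ S < ∞`, `1 ≤ p ≤ ∞` and a Banach-space valued `f`, writing `f_S = ⨍_S f dμ`:

* `Literature.Analysis.FunctionSpaces.enorm_setAverage_mul_rpow_le`: `‖⨍_S h‖ μ(S)^{1/p} ≤ ‖h‖_{L^p(S)}` (Hölder);
* `Literature.Analysis.FunctionSpaces.eLpNorm_sub_setAverage_le_two_mul`: `‖f - f_S‖_{L^p(S)} ≤ 2 ‖f - c‖_{L^p(S)}` for every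
  constant `c`;
* `Literature.Analysis.FunctionSpaces.enorm_setAverage_sub_setAverage_mul_rpow_le`: for two pieces `V`, `W`,
  `‖f_V - f_W‖ μ(V ∩ W)^{1/p} ≤ ‖f - f_V‖_{L^p(V)} + ‖f - f_W‖_{L^p(W)}`;
* `Literature.Analysis.FunctionSpaces.eLpNorm_restrict_le_sum_eLpNorm_restrict`: `‖g‖_{L^p(T)} ≤ Σ_i ‖g‖_{L^p(S_i)}` when
  `T ⊆ ⋃ S_i` (finite union);
* `Literature.Analysis.FunctionSpaces.exists_eLpNorm_sub_setAverage_le_of_finite_cover` (the gluing lemma): if a preconnected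
  set `Ω` of finite measure is a finite union of open sets `U_i` (for a measure positive on
  nonempty open sets), and constants `C_i < ∞` are given, there is `K < ∞` such that for every
  `f` integrable on `Ω` and every `G ∈ [0, ∞]`, the piecewise bounds
  `‖f - f_{U_i}‖_{L^p(U_i)} ≤ C_i G` imply `‖f - f_Ω‖_{L^p(Ω)} ≤ K G`. The constant `K` depends
  only on the cover, the `C_i`, `μ` and `p` — not on `f` — which is what makes the lemma usable
  for Poincaré inequalities (`G = ‖∇f‖_{L^p(Ω)}`). Connectedness enters through
  `IsPreconnected.induction₂`: the relation "the averages over `U_i` and `U_j` differ by at most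
  `K_{ij} G` for all `f`" is reflexive, symmetric, transitive and holds for overlapping pieces.

## References

* V. G. Maz'ja, *Sobolev Spaces*, Springer Series in Soviet Mathematics (1985), §1.1.11.
-/

noncomputable section

open MeasureTheory TopologicalSpace Filter Set
open scoped ENNReal NNReal Topology

namespace Literature.Analysis.FunctionSpaces

section Average

variable {α : Type*} [MeasurableSpace α] {μ : Measure α}

/-- `‖g‖_{L^p(T)} ≤ Σ_i ‖g‖_{L^p(S_i)}` for a measurable `T ⊆ ⋃_i S_i` (finitely many measurable
`S_i`) and `1 ≤ p ≤ ∞`: pointwise `‖g‖ ≤ Σ_i ‖1_{S_i} g‖` on `T`, then Minkowski. [folklore] -/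
theorem eLpNorm_restrict_le_sum_eLpNorm_restrict {F : Type*} [NormedAddCommGroup F]
    {ι : Type*} [Fintype ι] {S : ι → Set α}
    (hS : ∀ i, MeasurableSet (S i)) {t : Set α} (ht : MeasurableSet t) (htS : t ⊆ ⋃ i, S i)
    {g : α → F} (hg : AEStronglyMeasurable g (μ.restrict t)) {p : ℝ≥0∞} (hp : 1 ≤ p) :
    eLpNorm g p (μ.restrict t) ≤ ∑ i, eLpNorm g p (μ.restrict (S i)) := by
  classical
  calc eLpNorm g p (μ.restrict t)
      ≤ eLpNorm (fun x => ∑ i, ‖(S i).indicator g x‖) p (μ.restrict t) := by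
        refine eLpNorm_mono_ae_real ?_
        filter_upwards [ae_restrict_mem ht] with x hx
        obtain ⟨i, hi⟩ := mem_iUnion.1 (htS hx)
        calc ‖g x‖ = ‖(S i).indicator g x‖ := by rw [indicator_of_mem hi]
          _ ≤ ∑ j, ‖(S j).indicator g x‖ :=
            Finset.single_le_sum (f := fun j => ‖(S j).indicator g x‖)
              (fun j _ => norm_nonneg _) (Finset.mem_univ i)
    _ = eLpNorm (∑ i, fun x => ‖(S i).indicator g x‖) p (μ.restrict t) := by
        congr 1; ext x; simp only [Finset.sum_apply]
    _ ≤ ∑ i, eLpNorm (fun x => ‖(S i).indicator g x‖) p (μ.restrict t) :=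
        eLpNorm_sum_le (fun i _ => ((hg.indicator (hS i)).norm)) hp
    _ ≤ ∑ i, eLpNorm g p (μ.restrict (S i)) := by
        gcongr with i
        rw [eLpNorm_norm]
        calc eLpNorm ((S i).indicator g) p (μ.restrict t) ≤ eLpNorm ((S i).indicator g) p μ :=
              eLpNorm_mono_measure _ Measure.restrict_le_self
          _ = eLpNorm g p (μ.restrict (S i)) := eLpNorm_indicator_eq_eLpNorm_restrict (hS i)

variable {F : Type*} [NormedAddCommGroup F] [NormedSpace ℝ F]

/-- **Hölder bound for averages.** For `μ S < ∞`, `1 ≤ p ≤ ∞` and `h` (a.e.-strongly) measurable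
on `S`: `‖⨍_S h dμ‖ · μ(S)^{1/p} ≤ ‖h‖_{L^p(S, μ)}`. (For `μ S = 0` both the average and, when
`p < ∞`, the factor `μ(S)^{1/p}` vanish.) [folklore] -/
theorem enorm_setAverage_mul_rpow_le {s : Set α} (hs : μ s ≠ ∞) {p : ℝ≥0∞} (hp : 1 ≤ p)
    {h : α → F} (hh : AEStronglyMeasurable h (μ.restrict s)) :
    ‖⨍ x in s, h x ∂μ‖ₑ * μ s ^ (1 / p.toReal) ≤ eLpNorm h p (μ.restrict s) := by
  rcases eq_or_ne (μ s) 0 with hs0 | hs0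
  · have h0 : μ.restrict s = 0 := Measure.restrict_eq_zero.2 hs0
    simp [h0]
  have hreal : 0 < μ.real s := ENNReal.toReal_pos hs0 hs
  -- `‖⨍_S h‖ = (μ S)⁻¹ ‖∫_S h‖ ≤ (μ S)⁻¹ ‖h‖_{L¹(S)} ≤ (μ S)⁻¹ ‖h‖_{L^p(S)} μ(S)^{1 - 1/p}`
  have h1 : ‖⨍ x in s, h x ∂μ‖ₑ = (μ s)⁻¹ * ‖∫ x in s, h x ∂μ‖ₑ := by
    rw [setAverage_eq, enorm_smul, Real.enorm_of_nonneg (inv_nonneg.2 hreal.le),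
      ENNReal.ofReal_inv_of_pos hreal, measureReal_def, ENNReal.ofReal_toReal hs]
  have h2 : ‖∫ x in s, h x ∂μ‖ₑ ≤ eLpNorm h p (μ.restrict s) * μ s ^ (1 - 1 / p.toReal) := by
    calc ‖∫ x in s, h x ∂μ‖ₑ ≤ ∫⁻ x in s, ‖h x‖ₑ ∂μ := enorm_integral_le_lintegral_enorm _
      _ = eLpNorm h 1 (μ.restrict s) := eLpNorm_one_eq_lintegral_enorm.symm
      _ ≤ eLpNorm h p (μ.restrict s) * (μ.restrict s) univ ^ (1 / (1 : ℝ≥0∞).toReal - 1 / p.toReal) :=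
          eLpNorm_le_eLpNorm_mul_rpow_measure_univ hp hh
      _ = eLpNorm h p (μ.restrict s) * μ s ^ (1 - 1 / p.toReal) := by
          rw [Measure.restrict_apply_univ, ENNReal.toReal_one, div_one]
  calc ‖⨍ x in s, h x ∂μ‖ₑ * μ s ^ (1 / p.toReal)
      ≤ (μ s)⁻¹ * (eLpNorm h p (μ.restrict s) * μ s ^ (1 - 1 / p.toReal)) * μ s ^ (1 / p.toReal) := by
        rw [h1]; gcongr
    _ = eLpNorm h p (μ.restrict s) * ((μ s)⁻¹ * (μ s ^ (1 - 1 / p.toReal) * μ s ^ (1 / p.toReal))) := by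
        ring
    _ = eLpNorm h p (μ.restrict s) := by
        rw [← ENNReal.rpow_add _ _ hs0 hs, sub_add_cancel, ENNReal.rpow_one,
          ENNReal.inv_mul_cancel hs0 hs, mul_one]

/-- The average of `f - c` over `S` is `f_S - c` (`0 < μ S < ∞`, `f` integrable on `S`).
[folklore] -/
theorem setAverage_sub_const [CompleteSpace F] {s : Set α} (hs0 : μ s ≠ 0) (hs : μ s ≠ ∞) {f : α → F}
    (hf : IntegrableOn f s μ) (c : F) :
    ⨍ x in s, (f x - c) ∂μ = (⨍ x in s, f x ∂μ) - c := by
  haveI : IsFiniteMeasure (μ.restrict s) := isFiniteMeasure_restrict.2 hs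
  have hreal : 0 < μ.real s := ENNReal.toReal_pos hs0 hs
  rw [setAverage_eq, setAverage_eq, integral_sub hf (integrable_const c), setIntegral_const,
    smul_sub, smul_smul, inv_mul_cancel₀ hreal.ne', one_smul]

/-- **Averages are nearly optimal constants.** For `μ S < ∞`, `1 ≤ p ≤ ∞`, `f` integrable on
`S` and any constant `c`: `‖f - f_S‖_{L^p(S)} ≤ 2 ‖f - c‖_{L^p(S)}`, since
`f - f_S = (f - c) - ⨍_S (f - c)` and `‖⨍_S (f - c)‖ μ(S)^{1/p} ≤ ‖f - c‖_{L^p(S)}`.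
[folklore] -/
theorem eLpNorm_sub_setAverage_le_two_mul [CompleteSpace F] {s : Set α} (hs : μ s ≠ ∞) {p : ℝ≥0∞} (hp : 1 ≤ p)
    {f : α → F} (hf : IntegrableOn f s μ) (c : F) :
    eLpNorm (fun x => f x - ⨍ y in s, f y ∂μ) p (μ.restrict s) ≤
      2 * eLpNorm (fun x => f x - c) p (μ.restrict s) := by
  rcases eq_or_ne (μ s) 0 with hs0 | hs0
  · have h0 : μ.restrict s = 0 := Measure.restrict_eq_zero.2 hs0
    simp [h0]
  have hp0 : p ≠ 0 := (zero_lt_one.trans_le hp).ne'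
  have hfc : AEStronglyMeasurable (fun x => f x - c) (μ.restrict s) :=
    hf.aestronglyMeasurable.sub aestronglyMeasurable_const
  have key : (fun x => f x - ⨍ y in s, f y ∂μ) =
      (fun x => f x - c) - fun _ => ⨍ y in s, (f y - c) ∂μ := by
    ext x
    rw [Pi.sub_apply, setAverage_sub_const hs0 hs hf c]
    abel
  rw [key]
  calc eLpNorm ((fun x => f x - c) - fun _ => ⨍ y in s, (f y - c) ∂μ) p (μ.restrict s)
      ≤ eLpNorm (fun x => f x - c) p (μ.restrict s) +
          eLpNorm (fun _ : α => ⨍ y in s, (f y - c) ∂μ) p (μ.restrict s) :=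
        eLpNorm_sub_le hfc aestronglyMeasurable_const hp
    _ = eLpNorm (fun x => f x - c) p (μ.restrict s) +
          ‖⨍ y in s, (f y - c) ∂μ‖ₑ * μ s ^ (1 / p.toReal) := by
        rw [eLpNorm_const _ hp0 (fun h => hs0 (Measure.restrict_eq_zero.1 h)),
          Measure.restrict_apply_univ]
    _ ≤ eLpNorm (fun x => f x - c) p (μ.restrict s) + eLpNorm (fun x => f x - c) p (μ.restrict s) := by
        gcongr
        exact enorm_setAverage_mul_rpow_le hs hp hfc
    _ = 2 * eLpNorm (fun x => f x - c) p (μ.restrict s) := (two_mul _).symm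

/-- **Averages over overlapping pieces.** For sets `V`, `W` with `μ (V ∩ W) ≠ 0` and
`1 ≤ p ≤ ∞`: `‖f_V - f_W‖ · μ(V ∩ W)^{1/p} ≤ ‖f - f_V‖_{L^p(V)} + ‖f - f_W‖_{L^p(W)}`, because
the constant `f_V - f_W = (f - f_W) - (f - f_V)` on `V ∩ W` (Maz'ya, *Sobolev Spaces*, §1.1.11,
proof of the Lemma, chain of balls `𝓑_i ∩ 𝓑_{i+1} ≠ ∅`). [cite: Mazja1985, §1.1.11 Lemma (proof)] -/
theorem enorm_setAverage_sub_setAverage_mul_rpow_le {V W : Set α} (hVW : μ (V ∩ W) ≠ 0)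
    {p : ℝ≥0∞} (hp : 1 ≤ p) {f : α → F} (hfV : AEStronglyMeasurable f (μ.restrict V))
    (hfW : AEStronglyMeasurable f (μ.restrict W)) :
    ‖(⨍ y in V, f y ∂μ) - ⨍ y in W, f y ∂μ‖ₑ * μ (V ∩ W) ^ (1 / p.toReal) ≤
      eLpNorm (fun x => f x - ⨍ y in V, f y ∂μ) p (μ.restrict V) +
        eLpNorm (fun x => f x - ⨍ y in W, f y ∂μ) p (μ.restrict W) := by
  have hp0 : p ≠ 0 := (zero_lt_one.trans_le hp).ne'
  set a := ⨍ y in V, f y ∂μ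
  set b := ⨍ y in W, f y ∂μ
  have hVW' : μ.restrict (V ∩ W) ≠ 0 := fun h => hVW (Measure.restrict_eq_zero.1 h)
  have hV : μ.restrict (V ∩ W) ≤ μ.restrict V := Measure.restrict_mono inter_subset_left le_rfl
  have hW : μ.restrict (V ∩ W) ≤ μ.restrict W := Measure.restrict_mono inter_subset_right le_rfl
  have hfa : AEStronglyMeasurable (fun x => f x - a) (μ.restrict (V ∩ W)) :=
    (hfV.mono_measure hV).sub aestronglyMeasurable_const
  have hfb : AEStronglyMeasurable (fun x => f x - b) (μ.restrict (V ∩ W)) :=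
    (hfW.mono_measure hW).sub aestronglyMeasurable_const
  have key : (fun _ : α => a - b) = (fun x => f x - b) - fun x => f x - a := by
    ext x; simp only [Pi.sub_apply]; abel
  calc ‖a - b‖ₑ * μ (V ∩ W) ^ (1 / p.toReal)
      = eLpNorm (fun _ : α => a - b) p (μ.restrict (V ∩ W)) := by
        rw [eLpNorm_const _ hp0 hVW', Measure.restrict_apply_univ]
    _ ≤ eLpNorm (fun x => f x - b) p (μ.restrict (V ∩ W)) +
          eLpNorm (fun x => f x - a) p (μ.restrict (V ∩ W)) := by
        rw [key]; exact eLpNorm_sub_le hfb hfa hp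
    _ ≤ eLpNorm (fun x => f x - b) p (μ.restrict W) + eLpNorm (fun x => f x - a) p (μ.restrict V) :=
        add_le_add (eLpNorm_mono_measure _ hW) (eLpNorm_mono_measure _ hV)
    _ = _ := add_comm _ _

end Average

section Gluing

variable {E : Type*} [TopologicalSpace E] [MeasurableSpace E] [OpensMeasurableSpace E]
variable {μ : Measure E} [μ.IsOpenPosMeasure]
variable {F : Type*} [NormedAddCommGroup F] [NormedSpace ℝ F] [CompleteSpace F]

/-- **Gluing lemma for Poincaré inequalities** (Maz'ya, *Sobolev Spaces*, §1.1.11, proof of the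
Lemma: estimates on the star-shaped pieces `G` are combined along chains of overlapping balls
and then "summing over all `G`"). Let `Ω` be preconnected with `μ Ω < ∞`, covered by finitely
many open sets `U_i ⊆ Ω` (`Ω = ⋃ U_i`), let `μ` be positive on nonempty open sets, `1 ≤ p ≤ ∞`,
and let constants `C_i < ∞` be given. Then there is `K < ∞`, depending only on these data, such
that for every `f` integrable on `Ω` and every `G ∈ [0, ∞]`:
if `‖f - f_{U_i}‖_{L^p(U_i)} ≤ C_i G` for all `i`, then `‖f - f_Ω‖_{L^p(Ω)} ≤ K G`.
[cite: Mazja1985, §1.1.11 Lemma (proof)] -/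
theorem exists_eLpNorm_sub_setAverage_le_of_finite_cover {ι : Type*} [Fintype ι]
    (U : ι → Set E) (hUo : ∀ i, IsOpen (U i)) {Ω : Set E} (hΩ : Ω = ⋃ i, U i)
    (hc : IsPreconnected Ω) (hμΩ : μ Ω ≠ ∞) {p : ℝ≥0∞} (hp : 1 ≤ p) (C : ι → ℝ≥0∞)
    (hC : ∀ i, C i ≠ ∞) :
    ∃ K : ℝ≥0∞, K ≠ ∞ ∧ ∀ (f : E → F) (G : ℝ≥0∞), IntegrableOn f Ω μ →
      (∀ i, eLpNorm (fun x => f x - ⨍ y in U i, f y ∂μ) p (μ.restrict (U i)) ≤ C i * G) →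
      eLpNorm (fun x => f x - ⨍ y in Ω, f y ∂μ) p (μ.restrict Ω) ≤ K * G := by
  classical
  have hp0 : p ≠ 0 := (zero_lt_one.trans_le hp).ne'
  have hUΩ : ∀ i, U i ⊆ Ω := fun i => hΩ ▸ subset_iUnion U i
  have hΩo : IsOpen Ω := hΩ ▸ isOpen_iUnion hUo
  have hμU : ∀ i, μ (U i) ≠ ∞ := fun i => measure_ne_top_of_subset (hUΩ i) hμΩ
  -- the pair relation: averages over `U i` and `U j` are uniformly comparable
  set P : ι → ι → Prop := fun i j => ∃ K : ℝ≥0∞, K ≠ ∞ ∧ ∀ (f : E → F) (G : ℝ≥0∞),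
      IntegrableOn f Ω μ →
      (∀ i, eLpNorm (fun x => f x - ⨍ y in U i, f y ∂μ) p (μ.restrict (U i)) ≤ C i * G) →
      ‖(⨍ y in U i, f y ∂μ) - ⨍ y in U j, f y ∂μ‖ₑ ≤ K * G
  have P_symm : ∀ i j, P i j → P j i := by
    rintro i j ⟨K, hK, h⟩
    exact ⟨K, hK, fun f G hf hb => by rw [enorm_sub_rev]; exact h f G hf hb⟩
  have P_trans : ∀ i j k, P i j → P j k → P i k := by
    rintro i j k ⟨K₁, hK₁, h₁⟩ ⟨K₂, hK₂, h₂⟩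
    refine ⟨K₁ + K₂, ENNReal.add_ne_top.2 ⟨hK₁, hK₂⟩, fun f G hf hb => ?_⟩
    calc ‖(⨍ y in U i, f y ∂μ) - ⨍ y in U k, f y ∂μ‖ₑ
        ≤ ‖(⨍ y in U i, f y ∂μ) - ⨍ y in U j, f y ∂μ‖ₑ +
            ‖(⨍ y in U j, f y ∂μ) - ⨍ y in U k, f y ∂μ‖ₑ := by
          simpa only [edist_eq_enorm_sub] using
            edist_triangle (⨍ y in U i, f y ∂μ) (⨍ y in U j, f y ∂μ) (⨍ y in U k, f y ∂μ)
      _ ≤ K₁ * G + K₂ * G := add_le_add (h₁ f G hf hb) (h₂ f G hf hb)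
      _ = (K₁ + K₂) * G := (add_mul _ _ _).symm
  have P_of_nonempty : ∀ i j, (U i ∩ U j).Nonempty → P i j := by
    intro i j hij
    have hm0 : μ (U i ∩ U j) ≠ 0 := ((hUo i).inter (hUo j)).measure_ne_zero μ hij
    have hmt : μ (U i ∩ U j) ≠ ∞ := measure_ne_top_of_subset inter_subset_left (hμU i)
    set m : ℝ≥0∞ := μ (U i ∩ U j) ^ (1 / p.toReal) with hm
    have hm0' : m ≠ 0 := by
      rw [hm]; exact fun h => by
        rcases ENNReal.rpow_eq_zero_iff.1 h with ⟨h1, _⟩ | ⟨h1, h2⟩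
        · exact hm0 h1
        · exact hmt h1
    have hmt' : m ≠ ∞ := ENNReal.rpow_ne_top_of_nonneg (by positivity) hmt
    refine ⟨(C i + C j) * m⁻¹,
      ENNReal.mul_ne_top (ENNReal.add_ne_top.2 ⟨hC i, hC j⟩) (ENNReal.inv_ne_top.2 hm0'),
      fun f G hf hb => ?_⟩
    have key := enorm_setAverage_sub_setAverage_mul_rpow_le (μ := μ) hm0 hp
      (hf.mono_set (hUΩ i)).aestronglyMeasurable (hf.mono_set (hUΩ j)).aestronglyMeasurable
    calc ‖(⨍ y in U i, f y ∂μ) - ⨍ y in U j, f y ∂μ‖ₑ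
        = ‖(⨍ y in U i, f y ∂μ) - ⨍ y in U j, f y ∂μ‖ₑ * m * m⁻¹ := by
          rw [mul_assoc, ENNReal.mul_inv_cancel hm0' hmt', mul_one]
      _ ≤ (C i * G + C j * G) * m⁻¹ := by
          gcongr
          exact key.trans (add_le_add (hb i) (hb j))
      _ = (C i + C j) * m⁻¹ * G := by ring
  -- connectedness: all nonempty pieces are related
  have P_all : ∀ i j, (U i).Nonempty → (U j).Nonempty → P i j := by
    rintro i j ⟨x, hx⟩ ⟨y, hy⟩
    refine hc.induction₂ (fun x y => ∀ i j, x ∈ U i → y ∈ U j → P i j) ?_ ?_ ?_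
      (hUΩ i hx) (hUΩ j hy) i j hx hy
    · intro z hz
      obtain ⟨k, hk⟩ := mem_iUnion.1 (hΩ ▸ hz : z ∈ ⋃ i, U i)
      filter_upwards [mem_nhdsWithin_of_mem_nhds ((hUo k).mem_nhds hk)] with w hw
      intro i' j' hi' hj'
      exact P_trans _ _ _ (P_of_nonempty _ _ ⟨z, hi', hk⟩) (P_of_nonempty _ _ ⟨w, hw, hj'⟩)
    · intro x' y' z' _ hy' _ hxy hyz i' j' hi' hj'
      obtain ⟨k, hk⟩ := mem_iUnion.1 (hΩ ▸ hy' : y' ∈ ⋃ i, U i)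
      exact P_trans _ _ _ (hxy i' k hi' hk) (hyz k j' hk hj')
    · intro x' y' _ _ hxy i' j' hi' hj'
      exact P_symm _ _ (hxy j' i' hj' hi')
  -- the degenerate case `Ω = ∅`
  by_cases hne : ∃ i, (U i).Nonempty
  swap
  · refine ⟨0, ENNReal.zero_ne_top, fun f G _ _ => ?_⟩
    have hΩe : Ω = ∅ := by
      rw [hΩ]
      exact iUnion_eq_empty.2 fun i => not_nonempty_iff_eq_empty.1 fun h => hne ⟨i, h⟩
    simp [hΩe]
  obtain ⟨i₀, hi₀⟩ := hne
  -- constants comparing each nonempty piece with the base piece `U i₀`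
  have hK : ∀ i, ∃ K : ℝ≥0∞, K ≠ ∞ ∧ ((U i).Nonempty → ∀ (f : E → F) (G : ℝ≥0∞),
      IntegrableOn f Ω μ →
      (∀ i, eLpNorm (fun x => f x - ⨍ y in U i, f y ∂μ) p (μ.restrict (U i)) ≤ C i * G) →
      ‖(⨍ y in U i, f y ∂μ) - ⨍ y in U i₀, f y ∂μ‖ₑ ≤ K * G) := by
    intro i
    by_cases h : (U i).Nonempty
    · obtain ⟨K, hK, hK'⟩ := P_all i i₀ h hi₀
      exact ⟨K, hK, fun _ => hK'⟩
    · exact ⟨0, ENNReal.zero_ne_top, fun h' => absurd h' h⟩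
  choose K hK hK' using hK
  refine ⟨2 * ∑ i, (C i + K i * μ Ω ^ (1 / p.toReal)), ?_, fun f G hf hb => ?_⟩
  · refine ENNReal.mul_ne_top ENNReal.ofNat_ne_top (ENNReal.sum_ne_top.2 fun i _ => ?_)
    exact ENNReal.add_ne_top.2 ⟨hC i, ENNReal.mul_ne_top (hK i)
      (ENNReal.rpow_ne_top_of_nonneg (by positivity) hμΩ)⟩
  set c₀ := ⨍ y in U i₀, f y ∂μ
  have hfc : AEStronglyMeasurable (fun x => f x - c₀) (μ.restrict Ω) :=
    hf.aestronglyMeasurable.sub aestronglyMeasurable_const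
  calc eLpNorm (fun x => f x - ⨍ y in Ω, f y ∂μ) p (μ.restrict Ω)
      ≤ 2 * eLpNorm (fun x => f x - c₀) p (μ.restrict Ω) :=
        eLpNorm_sub_setAverage_le_two_mul hμΩ hp hf c₀
    _ ≤ 2 * ∑ i, eLpNorm (fun x => f x - c₀) p (μ.restrict (U i)) := by
        gcongr
        exact eLpNorm_restrict_le_sum_eLpNorm_restrict (fun i => (hUo i).measurableSet)
          hΩo.measurableSet hΩ.subset hfc hp
    _ ≤ 2 * ∑ i, (C i + K i * μ Ω ^ (1 / p.toReal)) * G := by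
        gcongr with i
        by_cases h : (U i).Nonempty
        · have hUi0 : μ.restrict (U i) ≠ 0 := fun h' =>
            (hUo i).measure_ne_zero μ h (Measure.restrict_eq_zero.1 h')
          have hfi : AEStronglyMeasurable (fun x => f x - ⨍ y in U i, f y ∂μ) (μ.restrict (U i)) :=
            (hf.mono_set (hUΩ i)).aestronglyMeasurable.sub aestronglyMeasurable_const
          have hsplit : (fun x => f x - c₀) =
              (fun x => f x - ⨍ y in U i, f y ∂μ) + fun _ => (⨍ y in U i, f y ∂μ) - c₀ := by
            ext x; simp only [Pi.add_apply]; abel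
          calc eLpNorm (fun x => f x - c₀) p (μ.restrict (U i))
              ≤ eLpNorm (fun x => f x - ⨍ y in U i, f y ∂μ) p (μ.restrict (U i)) +
                  eLpNorm (fun _ : E => (⨍ y in U i, f y ∂μ) - c₀) p (μ.restrict (U i)) := by
                rw [hsplit]; exact eLpNorm_add_le hfi aestronglyMeasurable_const hp
            _ = eLpNorm (fun x => f x - ⨍ y in U i, f y ∂μ) p (μ.restrict (U i)) +
                  ‖(⨍ y in U i, f y ∂μ) - c₀‖ₑ * μ (U i) ^ (1 / p.toReal) := by
                rw [eLpNorm_const _ hp0 hUi0, Measure.restrict_apply_univ]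
            _ ≤ C i * G + K i * G * μ Ω ^ (1 / p.toReal) := by
                gcongr
                · exact hb i
                · exact hK' i h f G hf hb
                · exact hUΩ i
            _ = (C i + K i * μ Ω ^ (1 / p.toReal)) * G := by ring
        · have hUe : U i = ∅ := not_nonempty_iff_eq_empty.1 h
          simp [hUe]
    _ = (2 * ∑ i, (C i + K i * μ Ω ^ (1 / p.toReal))) * G := by
        rw [mul_assoc, Finset.sum_mul]

end Gluing

end Literature.Analysis.FunctionSpaces
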